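import Summits.ValiantsHypothesis.ValiantsHypothesis.Theorems.DepthWindowBDSCore
import Summits.ValiantsHypothesis.ValiantsHypothesis.Theorems.DepthWindowBDSFit
import HarnessLib

/-!
# Route `DepthWindow` — the BDS kernel and fit at every slope `p/q ≤ 36/25` (print-range completion)

Helper file of the route `Theses/DepthWindow.lean` (decomp-valiant workshop; written by lens 2, generation 15, on the
naming of lens 4, bus 2026-08-30T07:11:30Z).  `DepthWindowBDSCore.homBds_core` + `DepthWindowBDSFit.fit` give the hard
column of the slope–rate dial at slope `7/5` (`homImmHardAt_seven_five`).  The Bhargav–Dutta–Saxena hierarchy is in print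
for every product-depth slope `σ < 1/log₂ φ ≈ 1.4404`; this file supplies the two ingredients for every rational slope
`p/q ≤ 36/25 = 1.44`, the consumer (`HomImmHardAt p q` for `25 p ≤ 36 q`, in the cone of `DepthWindowSlopeRate`) being
left to lens 4 as agreed on the bus:

* `homBds_core_gen` — `homBds_core` with the depth bound a FREE parameter `Δ`: given `2 ≤ Δ`,
  `(256(c+2)Δ)^{F_{Δ+2}} ≤ ⌊√L⌋`, `4⌊√L⌋ ≤ L` (`L = ⌊log₂ m⌋`, `d = ⌊√L⌋`), a homogeneous circuit of product-depth `≤ Δ`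
  computing `IMM_{m,d}` over `ℂ` has more than `m^c + c` gates (proof verbatim from `homBds_core`; the form `⌊7v/5⌋ + c`
  of `Δ` was never used there);
* `fit_slope` — the fit at slope `p/q` with `25 p ≤ 36 q`, `1 ≤ p`: eventually in `L`, with `v = ⌊log₂⌊log₂ L⌋⌋` and
  `Δ′ = ⌊p v/q⌋ + c`, `2 ≤ Δ′ ∧ (256(c+2)Δ′)^{F_{Δ′+2}} ≤ ⌊√L⌋ ∧ 4⌊√L⌋ ≤ L`.

The only new input is a sharper Fibonacci growth certificate.  At the boundary `25 p = 36 q` a rate of exactly `25/36`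
for `log₂ F` leaves no room for the base `256(c+2)Δ′ ≥ 2`, so the margin must come from `36 · log₂ φ = 24.9927 < 25`
itself: the Cassini pair `233² = 233·144 + 144² + 1` gives `F_{n+2}·144^n ≤ 2·233^n` by the two-step induction of
`DepthWindowBDSSequences.fib_succ_succ_mul_pow_le`, and the decidable certificate `233^157 ≤ 2^109 · 144^157` gives the
rate `109/157` with `36 · 109 = 3924 < 3925 = 25 · 157`; hence `F_{Δ′+2} ≤ 2^{⌊109 Δ′/157⌋ + 2}` and, with
`Δ′ ≤ ⌊36 v/25⌋ + c`, the slack `w = ⌊v/3925⌋` absorbs the base exactly as `w = ⌊v/50⌋` did at slope `7/5`.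

Unconditional, 0 sorry, def-free; rung currency only (known mathematics, [BhargavDuttaSaxena2024] Thm 1.4 / Rem. 1.5 in
its full print range) — nothing here bears on `VP ≠ VNP` itself.

References: [BhargavDuttaSaxena2024] Thm 1.4, Rem. 1.5, Lemma 4.3; [LimayeSrinivasanTavenas2025] Lemma 12.
-/

-- layout Summits/ValiantsHypothesis/ValiantsHypothesis forces the duplicated namespace component
set_option linter.dupNamespace false

namespace Summit.ValiantsHypothesis.ValiantsHypothesis.Theorems.DepthWindow

namespace BDS

open Nat

/-! ## A Fibonacci growth certificate of rate `109/157 < 25/36` -/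

/-- `F_{n+2} · 144^n ≤ 2 · 233^n`: two-step induction on the Cassini pair `233 · 144 + 144² = 54288 ≤ 54289 = 233²`. -/
theorem fib_succ_succ_mul_pow_le_cassini (n : ℕ) : fib (n + 2) * 144 ^ n ≤ 2 * 233 ^ n := by
  suffices h : ∀ n, fib (n + 2) * 144 ^ n ≤ 2 * 233 ^ n ∧ fib (n + 3) * 144 ^ (n + 1) ≤ 2 * 233 ^ (n + 1) from
    (h n).1
  intro n
  induction n with
  | zero => exact ⟨by decide, by decide⟩
  | succ n ih =>
    obtain ⟨h1, h2⟩ := ih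
    have h2' : fib (n + 3) * 144 ^ (n + 1) ≤ 2 * 233 ^ (n + 1) := h2
    refine ⟨h2', ?_⟩
    show fib (n + 4) * 144 ^ (n + 2) ≤ 2 * 233 ^ (n + 2)
    have e : fib (n + 4) = fib (n + 2) + fib (n + 3) := Nat.fib_add_two
    rw [e]
    calc (fib (n + 2) + fib (n + 3)) * 144 ^ (n + 2)
        = fib (n + 2) * 144 ^ n * 20736 + fib (n + 3) * 144 ^ (n + 1) * 144 := by ring
      _ ≤ 2 * 233 ^ n * 20736 + 2 * 233 ^ (n + 1) * 144 :=
          Nat.add_le_add (Nat.mul_le_mul_right _ h1) (Nat.mul_le_mul_right _ h2')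
      _ = 2 * 233 ^ n * 54288 := by ring
      _ ≤ 2 * 233 ^ n * 54289 := Nat.mul_le_mul_left _ (by norm_num)
      _ = 2 * 233 ^ (n + 2) := by ring

/-- The rate certificate: `233^157 ≤ 2^109 · 144^157` (`157 · log₂ (233/144) = 108.999 < 109`, and `36 · 109 < 25 · 157`). -/
theorem cassini_rate_cert : (233 : ℕ) ^ 157 ≤ 2 ^ 109 * 144 ^ 157 := by norm_num

/-- `F_{n+2}^157 ≤ 2^{109 n + 157}`. -/
theorem fib_succ_succ_pow_le_slope (n : ℕ) : fib (n + 2) ^ 157 ≤ 2 ^ (109 * n + 157) := by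
  have hN : (fib (n + 2) * 144 ^ n) ^ 157 ≤ (2 * 233 ^ n) ^ 157 :=
    Nat.pow_le_pow_left (fib_succ_succ_mul_pow_le_cassini n) 157
  have hrhs : (2 * 233 ^ n) ^ 157 ≤ 2 ^ (109 * n + 157) * (144 ^ n) ^ 157 := by
    have e1 : (2 * 233 ^ n) ^ 157 = 2 ^ 157 * (233 ^ 157) ^ n := by
      rw [mul_pow, ← pow_mul, ← pow_mul, mul_comm n 157]
    have e2 : 2 ^ (109 * n + 157) * (144 ^ n) ^ 157 = 2 ^ 157 * (2 ^ 109 * 144 ^ 157) ^ n := by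
      rw [mul_pow, ← pow_mul, ← pow_mul, ← pow_mul, pow_add, mul_comm n 157]
      ring
    rw [e1, e2]
    exact Nat.mul_le_mul_left _ (Nat.pow_le_pow_left cassini_rate_cert n)
  have hmul : fib (n + 2) ^ 157 * (144 ^ n) ^ 157 ≤ 2 ^ (109 * n + 157) * (144 ^ n) ^ 157 :=
    calc fib (n + 2) ^ 157 * (144 ^ n) ^ 157 = (fib (n + 2) * 144 ^ n) ^ 157 := by ring
      _ ≤ _ := hN.trans hrhs
  exact Nat.le_of_mul_le_mul_right hmul (by positivity)

/-- `F_{n+2} ≤ 2^{⌊109 n/157⌋ + 2}` — the Fibonacci exponents grow at rate at most `2^{(109/157) n}`, and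
`(109/157) · (36/25) = 3924/3925 < 1`. -/
theorem fib_le_two_pow_slope (n : ℕ) : fib (n + 2) ≤ 2 ^ (109 * n / 157 + 2) := by
  have h157 := fib_succ_succ_pow_le_slope n
  have hexp : 109 * n + 157 ≤ 157 * (109 * n / 157 + 2) := by omega
  have h : fib (n + 2) ^ 157 ≤ (2 ^ (109 * n / 157 + 2)) ^ 157 :=
    calc fib (n + 2) ^ 157 ≤ 2 ^ (109 * n + 157) := h157
      _ ≤ 2 ^ (157 * (109 * n / 157 + 2)) := Nat.pow_le_pow_right (by norm_num) hexp
      _ = (2 ^ (109 * n / 157 + 2)) ^ 157 := by rw [← pow_mul, mul_comm]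
  exact (Nat.pow_le_pow_iff_left (by norm_num)).1 h

/-! ## The fit at slope `p/q ≤ 36/25` -/

/-- Slope bookkeeping: `25 p ≤ 36 q` gives `⌊p v/q⌋ ≤ ⌊36 v/25⌋`. -/
theorem mul_div_le_of_slope {p q : ℕ} (hq : 0 < q) (h : 25 * p ≤ 36 * q) (v : ℕ) :
    p * v / q ≤ 36 * v / 25 := by
  rw [Nat.le_div_iff_mul_le (by norm_num)]
  have h1 : p * v / q * q ≤ p * v := Nat.div_mul_le_self _ _
  have h2 : (p * v / q * 25) * q ≤ 36 * v * q :=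
    calc (p * v / q * 25) * q = 25 * (p * v / q * q) := by ring
      _ ≤ 25 * (p * v) := Nat.mul_le_mul_left _ h1
      _ = (25 * p) * v := by ring
      _ ≤ (36 * q) * v := Nat.mul_le_mul_right _ h
      _ = 36 * v * q := by ring
  exact Nat.le_of_mul_le_mul_right h2 hq

/-- **The fit at slope `p/q ≤ 36/25`**: for every constant `C` and depth offset `c`, eventually in `L`,
`(C·Δ′)^{F_{Δ′+2}} ≤ ⌊√L⌋` where `Δ′ = ⌊p v/q⌋ + c`, `v = ⌊log₂ ⌊log₂ L⌋⌋`.  (With `w = ⌊v/3925⌋`: the base costs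
`C·Δ′·2^{c+3} ≤ 2^w` by `lin_le_two_pow`, the exponent `F_{Δ′+2} ≤ 2^{⌊109 Δ′/157⌋ + 2}`, and
`w + ⌊109 Δ′/157⌋ ≤ v + c` because `Δ′ ≤ ⌊36 v/25⌋ + c` and `109 · 36 = 3924 = 157 · 25 - 1`; so
`2·(CΔ′)·F_{Δ′+2} ≤ 2^v ≤ ⌊log₂ L⌋` and `(CΔ′)^{2F} ≤ 2^{2 CΔ′ F} ≤ L`.) [cite: BhargavDuttaSaxena2024, Lemma 4.3] -/
theorem base_pow_fib_le_sqrt_slope (C p q c : ℕ) (hq : 0 < q) (h : 25 * p ≤ 36 * q) :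
    ∃ L₀ : ℕ, ∀ L : ℕ, L₀ ≤ L →
    (C * (p * log 2 (log 2 L) / q + c)) ^ fib (p * log 2 (log 2 L) / q + c + 2) ≤ Nat.sqrt L := by
  -- the linear-vs-exponential threshold
  set a := 7850 * C * 2 ^ (c + 3) with ha
  set b := C * (7848 + c) * 2 ^ (c + 3) with hb
  set w₀ := 2 * (a + b + 1) with hw₀
  refine ⟨2 ^ 2 ^ (3925 * w₀), fun L hL => ?_⟩
  set u := log 2 L with hu
  set v := log 2 u with hv
  have hL0 : L ≠ 0 := by
    have : 1 ≤ 2 ^ 2 ^ (3925 * w₀) := Nat.one_le_two_pow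
    omega
  have huge : 2 ^ (3925 * w₀) ≤ u := Nat.le_log_of_pow_le (by norm_num) hL
  have hu0 : u ≠ 0 := by
    have : 1 ≤ 2 ^ (3925 * w₀) := Nat.one_le_two_pow
    omega
  have hvge : 3925 * w₀ ≤ v := Nat.le_log_of_pow_le (by norm_num) huge
  have h2v : 2 ^ v ≤ u := Nat.pow_log_le_self 2 hu0
  have h2u : 2 ^ u ≤ L := Nat.pow_log_le_self 2 hL0
  -- `w = ⌊v/3925⌋`
  set w := v / 3925 with hw
  have hw₀w : w₀ ≤ w := by omega
  have hv' : v ≤ 3925 * w + 3924 := by omega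
  -- the slope enters only here: `⌊p v/q⌋ ≤ ⌊36 v/25⌋`
  set t := p * v / q with ht
  have htv : t ≤ 36 * v / 25 := mul_div_le_of_slope hq h v
  set Δ' := t + c with hΔ'
  set X := C * Δ' with hX
  set E := fib (Δ' + 2) with hE
  have hEle : E ≤ 2 ^ (109 * Δ' / 157 + 2) := fib_le_two_pow_slope Δ'
  -- the base
  have hXle : X * 2 ^ (c + 3) ≤ 2 ^ w := by
    have hΔ : Δ' ≤ 2 * (3925 * w + 3924) + c := by omega
    calc X * 2 ^ (c + 3) ≤ C * (2 * (3925 * w + 3924) + c) * 2 ^ (c + 3) :=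
          Nat.mul_le_mul_right _ (Nat.mul_le_mul_left _ hΔ)
      _ = a * w + b := by rw [ha, hb]; ring
      _ ≤ 2 ^ w := lin_le_two_pow a b w hw₀w
  -- base times exponent
  have hXE : X * E * 2 ^ (c + 3) ≤ 2 ^ (v + c + 2) := by
    calc X * E * 2 ^ (c + 3) = (X * 2 ^ (c + 3)) * E := by ring
      _ ≤ 2 ^ w * 2 ^ (109 * Δ' / 157 + 2) := Nat.mul_le_mul hXle hEle
      _ = 2 ^ (w + (109 * Δ' / 157 + 2)) := by rw [← pow_add]
      _ ≤ 2 ^ (v + c + 2) := Nat.pow_le_pow_right (by norm_num) (by omega)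
  have hXE' : 2 * (X * E) ≤ 2 ^ v := by
    have e : 2 ^ (v + c + 2) = 2 ^ (v - 1) * 2 ^ (c + 3) := by
      rw [← pow_add]; congr 1; omega
    rw [e] at hXE
    have h := Nat.le_of_mul_le_mul_right hXE (by positivity)
    have e2 : 2 ^ v = 2 * 2 ^ (v - 1) := by
      rw [← pow_succ']; congr 1; omega
    rw [e2]
    exact Nat.mul_le_mul_left _ h
  -- assemble: `(X^E)^2 ≤ 2^{2XE} ≤ 2^u ≤ L`
  rw [Nat.le_sqrt']
  have hXlt : X ≤ 2 ^ X := (Nat.lt_two_pow_self).le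
  calc (X ^ E) ^ 2 ≤ ((2 ^ X) ^ E) ^ 2 := Nat.pow_le_pow_left (Nat.pow_le_pow_left hXlt _) _
    _ = 2 ^ (2 * (X * E)) := by rw [← pow_mul, ← pow_mul]; ring_nf
    _ ≤ 2 ^ u := Nat.pow_le_pow_right (by norm_num) (hXE'.trans h2v)
    _ ≤ L := h2u

/-- **The fit at slope `p/q`, packaged** (`λ = 256(c+2)Δ′`, `Δ′ = ⌊p v/q⌋ + c`) for every `1 ≤ p`, `0 < q`,
`25 p ≤ 36 q`: eventually in `L = ⌊log₂ m⌋`, `2 ≤ Δ′`, `λ^{F_{Δ′+2}} ≤ ⌊√L⌋` and `4⌊√L⌋ ≤ L` — the hypotheses of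
`homBds_core_gen` at `Δ = Δ′`.  (`1 ≤ p` is what makes `Δ′ → ∞`; the corner `p = 0` is constant depth and is served by
the down-set lemma `HomImmHardAt.of_slope_le` downstream.) [cite: BhargavDuttaSaxena2024, Thm 1.4, Rem. 1.5] -/
theorem fit_slope (p q c : ℕ) (hp : 1 ≤ p) (hq : 0 < q) (h : 25 * p ≤ 36 * q) :
    ∃ L₀ : ℕ, ∀ L : ℕ, L₀ ≤ L →
    2 ≤ p * log 2 (log 2 L) / q + c ∧
    (256 * (c + 2) * (p * log 2 (log 2 L) / q + c)) ^ fib (p * log 2 (log 2 L) / q + c + 2) ≤ Nat.sqrt L ∧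
    4 * Nat.sqrt L ≤ L := by
  obtain ⟨L₀, hL₀⟩ := base_pow_fib_le_sqrt_slope (256 * (c + 2)) p q c hq h
  refine ⟨max L₀ (2 ^ 2 ^ (2 * q)), fun L hL => ⟨?_, hL₀ L (le_of_max_le_left hL), ?_⟩⟩
  · have hL4 : 2 ^ 2 ^ (2 * q) ≤ L := le_of_max_le_right hL
    have hu : 2 ^ (2 * q) ≤ log 2 L := Nat.le_log_of_pow_le (by norm_num) hL4
    have hv : 2 * q ≤ log 2 (log 2 L) := Nat.le_log_of_pow_le (by norm_num) hu
    have h1 : 2 ≤ log 2 (log 2 L) / q := (Nat.le_div_iff_mul_le hq).2 hv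
    have h2 : log 2 (log 2 L) / q ≤ p * log 2 (log 2 L) / q :=
      Nat.div_le_div_right (Nat.le_mul_of_pos_left _ hp)
    omega
  · have hq2 : 2 ^ 2 ≤ 2 ^ (2 * q) := Nat.pow_le_pow_right (by norm_num) (by omega)
    have hL16 : 2 ^ 2 ^ 2 ≤ L := (Nat.pow_le_pow_right (by norm_num) hq2).trans (le_of_max_le_right hL)
    have h4 : 4 ≤ Nat.sqrt L := by
      rw [Nat.le_sqrt]
      exact le_trans (by norm_num) hL16
    calc 4 * Nat.sqrt L ≤ Nat.sqrt L * Nat.sqrt L := Nat.mul_le_mul_right _ h4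
      _ ≤ L := Nat.sqrt_le L

end BDS

/-! ## The BDS kernel with a free depth parameter -/

open MvPolynomial Literature.Computability.AlgebraicComplexity ArithCircuit

noncomputable section

/-- **The kernel of the hard column, depth-generic**: with `L = ⌊log₂ m⌋`, `d = ⌊√L⌋` as named parameters and ANY depth
bound `Δ` satisfying the fit `2 ≤ Δ`, `(256(c+2)Δ)^{F_{Δ+2}} ≤ ⌊√L⌋`, `4⌊√L⌋ ≤ L`, a homogeneous circuit of product-depth
`≤ Δ` computing `IMM_{m,d}` over `ℂ` has more than `m^c + c` gates.  (`homBds_core` is the case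
`Δ = ⌊7⌊log₂⌊log₂ L⌋⌋/5⌋ + c` past the threshold of `BDS.fit c`; `BDS.fit_slope` supplies the fit at every slope
`p/q ≤ 36/25`.)  Proof verbatim from `homBds_core`: `(s d^d + 1)^Δ ≥ 2^{L(λ-32)/128} ≥ 2^{(2(c+2)Δ-1)L}` against
`(s d^d+1)^Δ ≤ 2^{((L+1)c+c+L+1)Δ}` for `s ≤ m^c + c` — absurd for `Δ ≥ 2`, `L ≥ 4`.
[cite: BhargavDuttaSaxena2024, Thm 1.4, Rem. 1.5] -/
theorem homBds_core_gen (c Δ m : ℕ) {d L : ℕ} (hL : L = Nat.log 2 m) (hd : d = Nat.sqrt L) (hΔ2 : 2 ≤ Δ)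
    (hfit : (256 * (c + 2) * Δ) ^ Nat.fib (Δ + 2) ≤ Nat.sqrt L) (h4 : 4 * Nat.sqrt L ≤ L)
    (D : ArithCircuit ℂ (Fin d × Fin m × Fin m))
    (hhom : ∀ v ∈ ArithCircuit.gateValues D.gates, ∃ e : ℕ, v.IsHomogeneous e)
    (hD : D.Computes (immPoly m d ℂ)) (hpd : D.productDepth ≤ Δ) :
    m ^ c + c < D.size := by
  set lam := 256 * (c + 2) * Δ with hlam
  have hlam32 : 32 ≤ lam := by rw [hlam]; nlinarith
  have hdd : d * d ≤ L := by rw [hd]; exact Nat.sqrt_le L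
  have hd4 : 4 * d ≤ L := by rw [hd]; exact h4
  have hd1 : 1 ≤ d := by
    have h1 : 1 ≤ lam ^ Nat.fib (Δ + 2) := Nat.one_le_pow _ _ (by omega)
    rw [hd]; omega
  have hL4 : 4 ≤ L := by omega
  have hfit' : lam ^ Nat.fib (Δ + 2) ≤ lam * d := by
    calc lam ^ Nat.fib (Δ + 2) ≤ d := by rw [hd]; exact hfit
      _ ≤ lam * d := Nat.le_mul_of_pos_left d (by omega)
  have hdn : 4 * d ≤ Nat.log 2 m := hL ▸ hd4
  have h := BDS.homBds ℂ (Δ := Δ) (by omega) m d lam hd1 hlam32 hfit' hdn D hpd hhom hD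
  rw [← hL] at h
  -- an integer lower bound for the exponent: `(2(c+2)Δ - 1) L ≤ L (λ - 32)/128`
  have hE1 : 1 ≤ 2 * (c + 2) * Δ := by nlinarith
  have hexp : ((((2 * (c + 2) * Δ - 1) * L : ℕ)) : ℝ) ≤ (L : ℝ) * ((lam : ℝ) - 32) / 128 := by
    have hlamR : (lam : ℝ) = 256 * ((c : ℝ) + 2) * Δ := by rw [hlam]; push_cast; ring
    have hLR : (0 : ℝ) ≤ L := Nat.cast_nonneg _
    push_cast [Nat.cast_sub hE1]
    rw [hlamR]
    nlinarith [hLR]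
  have hN : 2 ^ ((2 * (c + 2) * Δ - 1) * L) ≤ (D.size * d ^ d + 1) ^ Δ := by
    have h1 := (Real.rpow_le_rpow_of_exponent_le one_le_two hexp).trans h
    rw [Real.rpow_natCast] at h1
    exact_mod_cast h1
  -- suppose the circuit were small
  by_contra hs
  push Not at hs
  have hm2 : m < 2 ^ (L + 1) := by rw [hL]; exact Nat.lt_pow_succ_log_self one_lt_two m
  have hmc : m ^ c ≤ 2 ^ ((L + 1) * c) := by
    rw [pow_mul]; exact Nat.pow_le_pow_left hm2.le c
  have hmcc : m ^ c + c ≤ 2 ^ ((L + 1) * c + c) := by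
    have h1 : c + 1 ≤ 2 ^ c := Nat.lt_two_pow_self
    have h2 : 1 ≤ 2 ^ ((L + 1) * c) := Nat.one_le_two_pow
    calc m ^ c + c ≤ 2 ^ ((L + 1) * c) + 2 ^ ((L + 1) * c) * c := by nlinarith
      _ = 2 ^ ((L + 1) * c) * (c + 1) := by ring
      _ ≤ 2 ^ ((L + 1) * c) * 2 ^ c := Nat.mul_le_mul_left _ h1
      _ = 2 ^ ((L + 1) * c + c) := by rw [← pow_add]
  have hddL : d ^ d ≤ 2 ^ L := by
    calc d ^ d ≤ (2 ^ d) ^ d := Nat.pow_le_pow_left (Nat.lt_two_pow_self).le d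
      _ = 2 ^ (d * d) := by rw [← pow_mul]
      _ ≤ 2 ^ L := Nat.pow_le_pow_right (by norm_num) hdd
  have hup : D.size * d ^ d + 1 ≤ 2 ^ ((L + 1) * c + c + L + 1) := by
    have h1 : D.size * d ^ d ≤ 2 ^ ((L + 1) * c + c + L) := by
      rw [pow_add]; exact Nat.mul_le_mul (hs.trans hmcc) hddL
    have h2 : 1 ≤ 2 ^ ((L + 1) * c + c + L) := Nat.one_le_two_pow
    rw [pow_succ]; omega
  have hupΔ : (D.size * d ^ d + 1) ^ Δ ≤ 2 ^ (((L + 1) * c + c + L + 1) * Δ) := by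
    rw [pow_mul]; exact Nat.pow_le_pow_left hup Δ
  have hfin := (Nat.pow_le_pow_iff_right (by norm_num)).1 (hN.trans hupΔ)
  -- `(2(c+2)Δ - 1) L ≤ ((L+1)c + c + L + 1) Δ` is absurd for `Δ ≥ 2`, `L ≥ 4`
  zify [hE1] at hfin
  have hcZ : (0 : ℤ) ≤ c := by exact_mod_cast Nat.zero_le c
  have hΔZ : (2 : ℤ) ≤ Δ := by exact_mod_cast hΔ2
  have hLZ : (4 : ℤ) ≤ L := by exact_mod_cast hL4
  nlinarith [mul_nonneg (mul_nonneg hcZ (by linarith : (0 : ℤ) ≤ Δ)) (by linarith : (0 : ℤ) ≤ (L : ℤ) - 2),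
    mul_nonneg (by linarith : (0 : ℤ) ≤ (Δ : ℤ) - 2) (by linarith : (0 : ℤ) ≤ 3 * (L : ℤ) - 1)]

/-- **The slope-generic kernel past the slope-generic fit**: for `1 ≤ p`, `0 < q`, `25 p ≤ 36 q` and every `c` there is
`m₀` past which every homogeneous circuit of product-depth `≤ ⌊p⌊log₂⌊log₂⌊log₂ m⌋⌋⌋/q⌋ + c` computing
`IMM_{m,⌊√⌊log₂ m⌋⌋}` over `ℂ` has more than `m^c + c` gates — i.e. the body of `HomImmHardAt p q`
(`DepthWindowSlopeRate`, not imported here to stay out of the route file's cone), stated with `d`, `L` named.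
[cite: BhargavDuttaSaxena2024, Thm 1.4, Rem. 1.5] -/
theorem homBds_slope (p q c : ℕ) (hp : 1 ≤ p) (hq : 0 < q) (h : 25 * p ≤ 36 * q) :
    ∃ m₀ : ℕ, ∀ m : ℕ, m₀ ≤ m → ∀ {d L : ℕ}, L = Nat.log 2 m → d = Nat.sqrt L →
      ∀ D : ArithCircuit ℂ (Fin d × Fin m × Fin m),
        (∀ v ∈ ArithCircuit.gateValues D.gates, ∃ e : ℕ, v.IsHomogeneous e) →
        D.Computes (immPoly m d ℂ) → D.productDepth ≤ p * Nat.log 2 (Nat.log 2 L) / q + c →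
        m ^ c + c < D.size := by
  obtain ⟨L₀, hL₀⟩ := BDS.fit_slope p q c hp hq h
  refine ⟨2 ^ L₀, fun m hm d L hL hd D hhom hD hpd => ?_⟩
  have hLge : L₀ ≤ L := by rw [hL]; exact Nat.le_log_of_pow_le (by norm_num) hm
  obtain ⟨hΔ2, hfit, h4⟩ := hL₀ L hLge
  exact homBds_core_gen c _ m hL hd hΔ2 hfit h4 D hhom hD hpd

end

end Summit.ValiantsHypothesis.ValiantsHypothesis.Theorems.DepthWindow
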